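import Mathlib.GroupTheory.Abelianization.Finite
import Mathlib.GroupTheory.Perm.Cycle.Type
import Literature.IUT.HodgeTheaters.TemperedCoveringsProp24Sub
import HarnessLib

/-!
# [IUTchI] Prop. 2.4 (i), sub-node (L2a): "`Δ̂_X` is strongly torsion-free" — the typed `Σ`-form
# DERIVED from the printed form (torsion-free abelianizations of open subgroups)

Mochizuki, *Inter-universal Teichmüller theory I*, kurims manuscript (May 2020), §2, proof of
Proposition 2.4 (i), p. 50 l. 27: "since [as is well-known — cf., e.g., [Config], Remark 1.2.2] `Δ̂_X` is
*strongly torsion-free*" [cite: Mochizuki2012, Prop 2.4(i) p.50] (D-0012 claim key; nothing of the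
series is asserted here).  PROOF-ONLY companion of `TemperedCoveringsProp24Sub.lean` (abc-iut-w5-d119,
sub-DAG plan/L5/SUBDAG-IUTchI-Prop24.md, sub-row P24i.r4), seat abc-iut-w4-d055.

There the printed input is typed as `StableCurveTemperedData.StronglyTorsionFreeSigma`: for every open
`H ⊆ Δ̂_X`, detection of `h ∈ H` by a continuous character to a finite abelian `Σ`-GROUP persists to
every power `h ^ n`, `n ≥ 1` — i.e. "the maximal pro-`Σ` abelian quotient of `H` is torsion-free".  The
PRINTED notion ("strongly torsion-free" = every open subgroup has torsion-free [profinite]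
abelianization) is the same sentence with ALL finite abelian groups as targets (`Σ := Set.univ`).  This
file proves, for any compact totally disconnected topological group, that the printed form implies the
typed `Σ`-form for EVERY set of primes `Σ` (`SigmaCharDetects.pow_of_univ`), and concludes
`StableCurveTemperedData.stronglyTorsionFreeSigma_of_torsionFreeAb`.  (A torsion-free profinite abelian
group is the product of its pro-`l` Sylow parts, so its maximal pro-`Σ` quotient is a direct factor; the
proof below instead splits elements of FINITE abelian groups into `Σ`- and `Σ′`-primary parts (Bezout),
builds the `Σ`-component `h_Σ ∈ H` of `h` by compactness over the open normal subgroups of `H`, and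
applies the printed torsion-freeness to `h_Σ`.)  No new definition or Literature fact; typed ≠ discharged
(the printed input about the genuine `Δ̂_X` stays a named sub-DAG input); no bearing on [IUTchIII] Cor. 3.12.
-/

namespace Literature.IUT.HodgeTheaters

open _root_.Topology

universe v

namespace SigmaCharDetects

/-! ### Arithmetic: splitting a natural number into its `Σ`-part and its `Σ′`-part -/

/-- Every `m ≠ 0` factors as `m = s * t` with `s`, `t` coprime, all prime factors of `s` in `S` and all
prime factors of `t` outside `S`. [cite: Mochizuki2012, Prop 2.4(i) p.50] -/
theorem exists_split (S : Set ℕ) : ∀ m : ℕ, m ≠ 0 →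
    ∃ s t : ℕ, m = s * t ∧ Nat.Coprime s t ∧ (∀ p : ℕ, p.Prime → p ∣ s → p ∈ S) ∧
      (∀ p : ℕ, p.Prime → p ∣ t → p ∉ S) := by
  intro m
  induction m using Nat.strong_induction_on with
  | _ m ih =>
    intro hm
    classical
    by_cases h1 : m = 1
    · subst h1
      have h1 : ∀ p : ℕ, p.Prime → ¬ p ∣ 1 := fun p hp hd => absurd (Nat.le_of_dvd one_pos hd) (not_le.2 hp.one_lt)
      exact ⟨1, 1, rfl, Nat.coprime_one_left 1, fun p hp hd => (h1 p hp hd).elim, fun p hp hd => (h1 p hp hd).elim⟩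
    obtain ⟨p, hp, hpm⟩ := Nat.exists_prime_and_dvd h1
    obtain ⟨e, m', hndvd, hm'⟩ := Nat.exists_eq_pow_mul_and_not_dvd hm p hp.ne_one
    have hm'0 : m' ≠ 0 := by rintro rfl; exact hm (by rw [hm', mul_zero])
    have he : e ≠ 0 := by rintro rfl; rw [pow_zero, one_mul] at hm'; exact hndvd (hm' ▸ hpm)
    have hlt : m' < m := hm' ▸ lt_mul_left (Nat.pos_of_ne_zero hm'0) (Nat.one_lt_pow he hp.one_lt)
    obtain ⟨s', t', hst, hcop, hs', ht'⟩ := ih m' hlt hm'0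
    have hpt' : ¬ p ∣ t' := fun hd => hndvd (hst ▸ dvd_mul_of_dvd_right hd s')
    have hps' : ¬ p ∣ s' := fun hd => hndvd (hst ▸ dvd_mul_of_dvd_left hd t')
    by_cases hpS : p ∈ S
    · refine ⟨p ^ e * s', t', by rw [hm', hst, mul_assoc], ?_, ?_, ht'⟩
      · exact Nat.Coprime.mul_left (Nat.Coprime.pow_left e ((Nat.Prime.coprime_iff_not_dvd hp).2 hpt')) hcop
      · intro q hq hd
        rcases (Nat.Prime.dvd_mul hq).1 hd with h | h
        · rw [(Nat.prime_dvd_prime_iff_eq hq hp).1 (hq.dvd_of_dvd_pow h)]; exact hpS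
        · exact hs' q hq h
    · refine ⟨s', p ^ e * t', by rw [hm', hst]; ring, ?_, hs', ?_⟩
      · exact Nat.Coprime.mul_right (Nat.Coprime.pow_right e
          (Nat.Coprime.symm ((Nat.Prime.coprime_iff_not_dvd hp).2 hps'))) hcop
      · intro q hq hd
        rcases (Nat.Prime.dvd_mul hq).1 hd with h | h
        · rw [(Nat.prime_dvd_prime_iff_eq hq hp).1 (hq.dvd_of_dvd_pow h)]; exact hpS
        · exact ht' q hq h

/-! ### `Σ`- and `Σ′`-primary parts of elements of finite abelian groups

Throughout, "`y` is a `Σ`-element" is written out as `∀ p, p.Prime → p ∣ orderOf y → p ∈ S` and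
"`z` is a `Σ′`-element" as `∀ p, p.Prime → p ∣ orderOf z → p ∉ S` (no new definitions). -/

section FiniteAbelian

variable {B : Type v} [CommGroup B] (S : Set ℕ)

/-- Prime divisors of `orderOf (y * z)` divide `orderOf y` or `orderOf z` (commutative group).
[cite: Mochizuki2012, Prop 2.4(i) p.50] -/
theorem prime_dvd_orderOf_mul {y z : B} {p : ℕ} (hp : p.Prime) (hd : p ∣ orderOf (y * z)) :
    p ∣ orderOf y ∨ p ∣ orderOf z := by
  have h1 : orderOf (y * z) ∣ Nat.lcm (orderOf y) (orderOf z) := (Commute.all y z).orderOf_mul_dvd_lcm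
  have h2 : p ∣ orderOf y * orderOf z := (hd.trans h1).trans (Nat.lcm_dvd_mul _ _)
  exact (Nat.Prime.dvd_mul hp).1 h2

/-- `Σ`-elements are closed under multiplication. [cite: Mochizuki2012, Prop 2.4(i) p.50] -/
theorem sigma_mul {y y' : B} (hy : ∀ p : ℕ, p.Prime → p ∣ orderOf y → p ∈ S)
    (hy' : ∀ p : ℕ, p.Prime → p ∣ orderOf y' → p ∈ S) :
    ∀ p : ℕ, p.Prime → p ∣ orderOf (y * y') → p ∈ S := by
  intro p hp hd
  rcases prime_dvd_orderOf_mul hp hd with h | h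
  · exact hy p hp h
  · exact hy' p hp h

/-- `Σ′`-elements are closed under multiplication. [cite: Mochizuki2012, Prop 2.4(i) p.50] -/
theorem sigmaC_mul {z z' : B} (hz : ∀ p : ℕ, p.Prime → p ∣ orderOf z → p ∉ S)
    (hz' : ∀ p : ℕ, p.Prime → p ∣ orderOf z' → p ∉ S) :
    ∀ p : ℕ, p.Prime → p ∣ orderOf (z * z') → p ∉ S := by
  intro p hp hd
  rcases prime_dvd_orderOf_mul hp hd with h | h
  · exact hz p hp h
  · exact hz' p hp h

/-- `Σ`-elements are closed under inversion. [cite: Mochizuki2012, Prop 2.4(i) p.50] -/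
theorem sigma_inv {y : B} (hy : ∀ p : ℕ, p.Prime → p ∣ orderOf y → p ∈ S) :
    ∀ p : ℕ, p.Prime → p ∣ orderOf y⁻¹ → p ∈ S := by
  intro p hp hd; rw [orderOf_inv] at hd; exact hy p hp hd

/-- `Σ′`-elements are closed under inversion. [cite: Mochizuki2012, Prop 2.4(i) p.50] -/
theorem sigmaC_inv {z : B} (hz : ∀ p : ℕ, p.Prime → p ∣ orderOf z → p ∉ S) :
    ∀ p : ℕ, p.Prime → p ∣ orderOf z⁻¹ → p ∉ S := by
  intro p hp hd; rw [orderOf_inv] at hd; exact hz p hp hd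

/-- `Σ`-elements are closed under powers. [cite: Mochizuki2012, Prop 2.4(i) p.50] -/
theorem sigma_pow {y : B} (hy : ∀ p : ℕ, p.Prime → p ∣ orderOf y → p ∈ S) (n : ℕ) :
    ∀ p : ℕ, p.Prime → p ∣ orderOf (y ^ n) → p ∈ S :=
  fun p hp hd => hy p hp (hd.trans (orderOf_pow_dvd n))

/-- `Σ′`-elements are closed under powers. [cite: Mochizuki2012, Prop 2.4(i) p.50] -/
theorem sigmaC_pow {z : B} (hz : ∀ p : ℕ, p.Prime → p ∣ orderOf z → p ∉ S) (n : ℕ) :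
    ∀ p : ℕ, p.Prime → p ∣ orderOf (z ^ n) → p ∉ S :=
  fun p hp hd => hz p hp (hd.trans (orderOf_pow_dvd n))

/-- Homomorphic images of `Σ`-elements are `Σ`-elements. [cite: Mochizuki2012, Prop 2.4(i) p.50] -/
theorem sigma_map {B' : Type*} [CommGroup B'] (f : B →* B') {y : B}
    (hy : ∀ p : ℕ, p.Prime → p ∣ orderOf y → p ∈ S) :
    ∀ p : ℕ, p.Prime → p ∣ orderOf (f y) → p ∈ S :=
  fun p hp hd => hy p hp (hd.trans (orderOf_map_dvd f y))

/-- Homomorphic images of `Σ′`-elements are `Σ′`-elements. [cite: Mochizuki2012, Prop 2.4(i) p.50] -/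
theorem sigmaC_map {B' : Type*} [CommGroup B'] (f : B →* B') {z : B}
    (hz : ∀ p : ℕ, p.Prime → p ∣ orderOf z → p ∉ S) :
    ∀ p : ℕ, p.Prime → p ∣ orderOf (f z) → p ∉ S :=
  fun p hp hd => hz p hp (hd.trans (orderOf_map_dvd f z))

/-- An element that is both a `Σ`-element and a `Σ′`-element is trivial (an element of infinite order is
neither: every prime divides `orderOf w = 0`).
[cite: Mochizuki2012, Prop 2.4(i) p.50] -/
theorem eq_one_of_sigma_of_sigmaC {w : B}
    (h₁ : ∀ p : ℕ, p.Prime → p ∣ orderOf w → p ∈ S) (h₂ : ∀ p : ℕ, p.Prime → p ∣ orderOf w → p ∉ S) :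
    w = 1 := by
  rw [← orderOf_eq_one_iff]
  by_contra hne
  obtain ⟨p, hp, hd⟩ := Nat.exists_prime_and_dvd hne
  exact h₂ p hp hd (h₁ p hp hd)

/-- Uniqueness of the `Σ`-part in the primary decomposition. [cite: Mochizuki2012, Prop 2.4(i) p.50] -/
theorem sigma_decomp_unique {y z y' z' : B}
    (hy : ∀ p : ℕ, p.Prime → p ∣ orderOf y → p ∈ S) (hz : ∀ p : ℕ, p.Prime → p ∣ orderOf z → p ∉ S)
    (hy' : ∀ p : ℕ, p.Prime → p ∣ orderOf y' → p ∈ S) (hz' : ∀ p : ℕ, p.Prime → p ∣ orderOf z' → p ∉ S)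
    (h : y * z = y' * z') : y = y' := by
  have hw : y'⁻¹ * y = z' * z⁻¹ := by
    have e : y'⁻¹ * y * z = z' := by rw [mul_assoc, h, inv_mul_cancel_left]
    rw [← e, mul_inv_cancel_right]
  have h₁ := sigma_mul S (sigma_inv S hy') hy
  have h₂ := sigmaC_mul S hz' (sigmaC_inv S hz)
  rw [← hw] at h₂
  have := eq_one_of_sigma_of_sigmaC S h₁ h₂
  rw [inv_mul_eq_one] at this
  exact this.symm

/-- In a finite abelian group all of whose prime divisors (of the order) lie in `S`, every element is a
`Σ`-element. [cite: Mochizuki2012, Prop 2.4(i) p.50] -/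
theorem sigma_of_card (hS : ∀ p : ℕ, p.Prime → p ∣ Nat.card B → p ∈ S) (a : B) :
    ∀ p : ℕ, p.Prime → p ∣ orderOf a → p ∈ S :=
  fun p hp hd => hS p hp (hd.trans (orderOf_dvd_natCard a))

variable [Finite B]

/-- **Primary decomposition.**  Every element of a finite abelian group is the product of a
`Σ`-element and a `Σ′`-element (Bezout on the coprime `Σ`- and `Σ′`-parts of its order).
[cite: Mochizuki2012, Prop 2.4(i) p.50] -/
theorem exists_sigma_decomp (x : B) : ∃ y z : B, x = y * z ∧
    (∀ p : ℕ, p.Prime → p ∣ orderOf y → p ∈ S) ∧ (∀ p : ℕ, p.Prime → p ∣ orderOf z → p ∉ S) := by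
  have hm : orderOf x ≠ 0 := (orderOf_pos x).ne'
  obtain ⟨s, t, hst, hcop, hs, ht⟩ := exists_split S (orderOf x) hm
  obtain ⟨a, b, hab⟩ := Nat.isCoprime_iff_coprime.2 hcop
  refine ⟨x ^ ((b : ℤ) * t), x ^ ((a : ℤ) * s), ?_, ?_, ?_⟩
  · rw [← zpow_add]
    have : (b : ℤ) * t + a * s = 1 := by rw [add_comm]; exact hab
    rw [this, zpow_one]
  · have hy : (x ^ ((b : ℤ) * t)) ^ s = 1 := by
      rw [← zpow_natCast, ← zpow_mul, mul_assoc, ← Nat.cast_mul, mul_comm t s, ← hst, ← mul_comm,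
        zpow_mul, zpow_natCast, pow_orderOf_eq_one, one_zpow]
    intro p hp hd
    exact hs p hp (hd.trans (orderOf_dvd_of_pow_eq_one hy))
  · have hz : (x ^ ((a : ℤ) * s)) ^ t = 1 := by
      rw [← zpow_natCast, ← zpow_mul, mul_assoc, ← Nat.cast_mul, ← hst, ← mul_comm, zpow_mul,
        zpow_natCast, pow_orderOf_eq_one, one_zpow]
    intro p hp hd
    exact ht p hp (hd.trans (orderOf_dvd_of_pow_eq_one hz))

end FiniteAbelian

/-! ### The `Σ`-component of an element of a profinite group, and the main lemma -/

section Profinite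

variable {P : Type v} [Group P] [TopologicalSpace P] [IsTopologicalGroup P] [CompactSpace P]
  [TotallyDisconnectedSpace P]

/-- **The `Σ`-component `h_Σ` of `h`.**  In a compact totally disconnected group `G`, for every `h` there
is `h_Σ ∈ G` such that for every homomorphism `ψ : G → B` to a finite abelian group with open kernel,
`ψ(h_Σ)` is the `Σ`-part of `ψ(h)`: `ψ(h_Σ)` is a `Σ`-element and `ψ(h)·ψ(h_Σ)⁻¹` a `Σ′`-element.
(Compactness over the open normal subgroups `N ⊴ G`; nonemptiness at level `N` via the abelianization of
`G ⧸ N`.) [cite: Mochizuki2012, Prop 2.4(i) p.50] -/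
theorem exists_sigma_component {G : Type v} [Group G] [TopologicalSpace G] [IsTopologicalGroup G]
    [CompactSpace G] [TotallyDisconnectedSpace G] (S : Set ℕ) (h : G) :
    ∃ hS : G, ∀ (B : Type v) (_ : CommGroup B) (_ : Finite B) (ψ : G →* B),
      IsOpen ((ψ.ker : Subgroup G) : Set G) →
        (∀ p : ℕ, p.Prime → p ∣ orderOf (ψ hS) → p ∈ S) ∧
          (∀ p : ℕ, p.Prime → p ∣ orderOf (ψ h * (ψ hS)⁻¹) → p ∉ S) := by
  classical
  -- the level-`N` sets
  let T : OpenNormalSubgroup G → Set G := fun N =>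
    {x | ∀ (B : Type v) (_ : CommGroup B) (_ : Finite B) (ψ : G →* B), N.toSubgroup ≤ ψ.ker →
      (∀ p : ℕ, p.Prime → p ∣ orderOf (ψ x) → p ∈ S) ∧
        (∀ p : ℕ, p.Prime → p ∣ orderOf (ψ h * (ψ x)⁻¹) → p ∉ S)}
  -- saturation under `N`
  have hsat : ∀ (N : OpenNormalSubgroup G) (x y : G), x ∈ T N → x⁻¹ * y ∈ N → y ∈ T N := by
    intro N x y hx hxy B iB iF ψ hN
    have hψ : ψ y = ψ x := by
      have h1 : ψ (x⁻¹ * y) = 1 := hN hxy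
      rwa [map_mul, map_inv, inv_mul_eq_one, eq_comm] at h1
    rw [hψ]
    exact hx B iB iF ψ hN
  have hopen_of_sat : ∀ (N : OpenNormalSubgroup G) (U : Set G),
      (∀ x y : G, x ∈ U → x⁻¹ * y ∈ N → y ∈ U) → IsOpen U := by
    intro N U hU
    rw [isOpen_iff_mem_nhds]
    intro x hx
    have ho : IsOpen ((fun y : G => x⁻¹ * y) ⁻¹' (N : Set G)) :=
      N.isOpen'.preimage (continuous_const.mul continuous_id)
    refine Filter.mem_of_superset (ho.mem_nhds (by simp [Set.mem_preimage])) ?_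
    intro y hy
    exact hU x y hx hy
  have hclosed : ∀ N, IsClosed (T N) := by
    intro N
    rw [← isOpen_compl_iff]
    refine hopen_of_sat N (T N)ᶜ fun x y hx hxy hy => hx ?_
    have : y⁻¹ * x ∈ N := by
      have := N.toSubgroup.inv_mem hxy
      rwa [mul_inv_rev, inv_inv] at this
    exact hsat N y x hy this
  -- nonempty, via the abelianization of `G ⧸ N`
  have hne : ∀ N, (T N).Nonempty := by
    intro N
    let Q := G ⧸ N.toSubgroup
    haveI : Finite Q := Subgroup.quotient_finite_of_isOpen _ N.isOpen'
    let B₀ := Abelianization Q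
    let ψ₀ : G →* B₀ := Abelianization.of.comp (QuotientGroup.mk' N.toSubgroup)
    have hψ₀ : Function.Surjective ψ₀ :=
      (QuotientGroup.mk_surjective).comp (QuotientGroup.mk'_surjective _)
    obtain ⟨y, z, hyz, hy, hz⟩ := exists_sigma_decomp S (ψ₀ h)
    obtain ⟨x, hx⟩ := hψ₀ y
    refine ⟨x, fun B iB iF ψ hN => ?_⟩
    -- `ψ` factors through `ψ₀`
    let φ : B₀ →* B := Abelianization.lift (QuotientGroup.lift N.toSubgroup ψ hN)
    have hφ : ∀ w : G, ψ w = φ (ψ₀ w) := fun w => rfl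
    rw [hφ, hφ, hx, hyz]
    refine ⟨sigma_map S φ hy, ?_⟩
    rw [← map_inv, ← map_mul, mul_inv_cancel_comm]
    exact sigmaC_map S φ hz
  -- directed (antitone in `N`)
  have hanti : ∀ N N' : OpenNormalSubgroup G, N ≤ N' → T N ⊆ T N' := by
    intro N N' hNN' x hx B iB iF ψ hN'
    exact hx B iB iF ψ (fun w hw => hN' (hNN' hw))
  have hdir : Directed (· ⊇ ·) T := by
    intro N₁ N₂
    exact ⟨N₁ ⊓ N₂, hanti _ _ inf_le_left, hanti _ _ inf_le_right⟩
  -- compactness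
  obtain ⟨N₀, -⟩ := ProfiniteGrp.exist_openNormalSubgroup_sub_open_nhds_of_one (G := G) isOpen_univ
    (Set.mem_univ 1)
  haveI : Nonempty (OpenNormalSubgroup G) := ⟨N₀⟩
  obtain ⟨hS, hhS⟩ := IsCompact.nonempty_iInter_of_directed_nonempty_isCompact_isClosed T hdir hne
    (fun N => (hclosed N).isCompact) hclosed
  refine ⟨hS, fun B iB iF ψ hker => ?_⟩
  obtain ⟨N, hN⟩ := ProfiniteGrp.exist_openNormalSubgroup_sub_open_nhds_of_one (G := G) hker
    (one_mem ψ.ker)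
  exact Set.mem_iInter.1 hhS N B iB iF ψ (fun w hw => hN hw)

/-- **Torsion-free abelianization ⇒ torsion-free maximal pro-`Σ` abelian quotient**, in the character
language of `SigmaCharDetects`: for an open subgroup `H` of a compact totally disconnected group `P`, if
detection by continuous characters to ALL finite abelian groups persists to powers on `H` (every open
subgroup has torsion-free abelianization — "[as is well-known — cf., e.g., [Config], Remark 1.2.2] `Δ̂_X` is
strongly torsion-free", p. 50 l. 27), then detection by continuous characters to finite abelian
`Σ`-groups persists to powers, for every set of primes `Σ`. [cite: Mochizuki2012, Prop 2.4(i) p.50] -/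
theorem pow_of_univ (H : Subgroup P) (hH : IsOpen (H : Set P))
    (hTF : ∀ (g : H) (n : ℕ), n ≠ 0 →
      SigmaCharDetects Set.univ H g → SigmaCharDetects Set.univ H (g ^ n))
    (S : Set ℕ) (h : H) (n : ℕ) (hn : n ≠ 0) (hdet : SigmaCharDetects S H h) :
    SigmaCharDetects S H (h ^ n) := by
  classical
  haveI : CompactSpace H := isCompact_iff_compactSpace.mp (Subgroup.isClosed_of_isOpen H hH).isCompact
  obtain ⟨A, _, _, χ, hχker, hAS, hχh⟩ := hdet
  -- the `Σ`-component of `h`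
  obtain ⟨hS, hhS⟩ := exists_sigma_component S h
  -- `χ(h_Σ) = χ(h) ≠ 1`: `h_Σ` is detected
  have hχhS : χ hS = χ h := by
    obtain ⟨h1, h2⟩ := hhS A inferInstance inferInstance χ hχker
    have h3 : ∀ p : ℕ, p.Prime → p ∣ orderOf (χ h * (χ hS)⁻¹) → p ∈ S :=
      sigma_mul S (sigma_of_card S hAS _) (sigma_inv S h1)
    have := eq_one_of_sigma_of_sigmaC S h3 h2
    rw [mul_inv_eq_one] at this
    exact this.symm
  have hdetS : SigmaCharDetects Set.univ H hS :=
    ⟨A, inferInstance, inferInstance, χ, hχker, fun p _ _ => Set.mem_univ p, by rw [hχhS]; exact hχh⟩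
  -- torsion-freeness of the abelianization, applied to `h_Σ`
  obtain ⟨B, _, _, ψ, hψker, -, hψne⟩ := hTF hS n hn hdetS
  by_contra hnot
  apply hψne
  -- every `Σ`-character kills `h ^ n`; in particular `ψ` followed by `B ↠ B / B_{Σ′}`
  let T' : Subgroup B :=
    { carrier := {z | ∀ p : ℕ, p.Prime → p ∣ orderOf z → p ∉ S}
      mul_mem' := fun hz hz' => sigmaC_mul S hz hz'
      one_mem' := by
        intro p hp hd
        rw [orderOf_one] at hd
        exact absurd (Nat.le_of_dvd one_pos hd) (not_le.2 hp.one_lt)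
      inv_mem' := fun hz => sigmaC_inv S hz }
  have hT' : ∀ z : B, z ∈ T' ↔ ∀ p : ℕ, p.Prime → p ∣ orderOf z → p ∉ S := fun z => Iff.rfl
  let χ' : H →* B ⧸ T' := (QuotientGroup.mk' T').comp ψ
  have hχ'ker : IsOpen ((χ'.ker : Subgroup H) : Set H) := by
    refine Subgroup.isOpen_mono ?_ hψker
    intro w hw
    rw [MonoidHom.mem_ker] at hw ⊢
    simp [χ', hw]
  have hcardS : ∀ p : ℕ, p.Prime → p ∣ Nat.card (B ⧸ T') → p ∈ S := by
    intro p hp hd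
    haveI := Fact.mk hp
    obtain ⟨q, hq⟩ := exists_prime_orderOf_dvd_card' p hd
    obtain ⟨x, rfl⟩ := QuotientGroup.mk_surjective q
    obtain ⟨y, z, hyz, hy, hz⟩ := exists_sigma_decomp S x
    have hxy : (QuotientGroup.mk x : B ⧸ T') = QuotientGroup.mk' T' y := by
      rw [QuotientGroup.mk'_apply, hyz, QuotientGroup.mk_mul,
        (QuotientGroup.eq_one_iff z).2 ((hT' z).2 hz), mul_one]
    rw [hxy] at hq
    have := sigma_map S (QuotientGroup.mk' T') hy
    exact this p hp (by rw [hq])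
  have hkill : χ' (h ^ n) = 1 := by
    by_contra hne'
    exact hnot ⟨B ⧸ T', inferInstance, inferInstance, χ', hχ'ker, hcardS, hne'⟩
  -- so `ψ(h)^n` is a `Σ′`-element
  have hψhn : ∀ p : ℕ, p.Prime → p ∣ orderOf (ψ h ^ n) → p ∉ S := by
    have : ψ (h ^ n) ∈ T' := by
      rw [← QuotientGroup.eq_one_iff]
      simpa [χ'] using hkill
    rw [map_pow] at this
    exact (hT' _).1 this
  -- and `ψ(h_Σ)^n` is both a `Σ`-element and a `Σ′`-element
  obtain ⟨h1, h2⟩ := hhS B inferInstance inferInstance ψ hψker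
  have hSig : ∀ p : ℕ, p.Prime → p ∣ orderOf (ψ hS ^ n) → p ∈ S := sigma_pow S h1 n
  have hSigC : ∀ p : ℕ, p.Prime → p ∣ orderOf (ψ hS ^ n) → p ∉ S := by
    have e : ψ hS ^ n = ((ψ h * (ψ hS)⁻¹) ^ n)⁻¹ * ψ h ^ n := by
      rw [mul_pow, inv_pow, mul_inv_rev, inv_inv, mul_assoc, inv_mul_cancel, mul_one]
    rw [e]
    exact sigmaC_mul S (sigmaC_inv S (sigmaC_pow S h2 n)) hψhn
  rw [map_pow]
  exact eq_one_of_sigma_of_sigmaC S hSig hSigC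

end Profinite

end SigmaCharDetects

/-! ### The L5 corollary: sub-row P24i.r4 of SUBDAG-IUTchI-Prop24 reduced to print -/

namespace StableCurveTemperedData

universe u

variable {D : StableCurveTemperedData.{u}}

/-- **[IUTchI] Prop. 2.4 (i), input "`Δ̂_X` is strongly torsion-free" ([Config] Rmk 1.2.2, p. 50 l. 27):
the typed `Σ`-form `StronglyTorsionFreeSigma` FOLLOWS from the printed form** — every open subgroup
`H ⊆ Δ̂_X` has torsion-free abelianization, stated in the same character language with all finite abelian
targets (`Σ := Set.univ`) — for `Π̂_X` profinite and `Δ̂_X` closed.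
[cite: Mochizuki2012, Prop 2.4(i) p.50] -/
theorem stronglyTorsionFreeSigma_of_torsionFreeAb [TotallyDisconnectedSpace D.PiHat]
    (hΔc : D.DeltaHatClosed)
    (hTF : ∀ H : Subgroup D.DeltaHat, IsOpen (H : Set D.DeltaHat) →
      ∀ (h : H) (n : ℕ), n ≠ 0 →
        SigmaCharDetects Set.univ H h → SigmaCharDetects Set.univ H (h ^ n)) :
    D.StronglyTorsionFreeSigma := by
  haveI : CompactSpace D.DeltaHat := isCompact_iff_compactSpace.mp hΔc.isCompact
  intro H hH h n hn hdet
  exact SigmaCharDetects.pow_of_univ H hH (hTF H hH) D.graph.Sigma h n hn hdet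

end StableCurveTemperedData

end Literature.IUT.HodgeTheaters
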